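import Literature.AlgebraicGeometry.Frobenioids.BiratUnitsDiv
import Literature.AlgebraicGeometry.Frobenioids.ModelFrobenioidComparison
import HarnessLib

/-!
# Frobenioids I, Prop. 4.4 (ii) / Prop. 2.2 (ii): units commuting with an arrow of `C` are intertwined in `C^birat`

Mochizuki, *The geometry of Frobenioids I: the general theory*, Kyushu J. Math. **62** (2008) 293–400,
Prop. 4.4 (ii) p. 83 ("the natural map `O^×(A) → O^×(A^birat)`") and Prop. 2.2 (ii)(a) p. 45 (transport of
units along morphisms, "`β ∘ φ = φ ∘ α`") [cite: MochizukiFrdI2008, Prop. 2.2(ii) p.45].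

Generic proof-only lemma (abc-iut cell, layer L1, row M13-c3 input for the unit-germ transport law «(T-unit)»
of HOME/staging/L1/L1-t6/g3/M13-c3-DESIGN.md; seat abc-iut-L1-t6): if units `u ∈ O^×(A)`, `v ∈ O^×(A')` satisfy
`u ≫ ψ = ψ ≫ v` in `C` for an arbitrary arrow `ψ : A → A'`, then their images under abc-iut-L1-t10's
`unitsToBirat` ([FrdI] Prop. 4.4 (ii)) are INTERTWINED along `ψ` in the sense of abc-iut-L6-t8's
`BiratUnits.Intertwines` (the relation "`ψ ∘ u = v ∘ ψ` in `C^birat`" of `RationalFunctionMonoidStr.natural`),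
with the trivial refinement (`κ = id`, `l = ψ`).  So the unit part of a naturality proof for a rational function
monoid reduces to a commuting square of honest units in `C`.  No definitions; nothing here bears on [IUTchIII] Cor. 3.12.
-/

namespace Literature.AlgebraicGeometry.Frobenioids

open CategoryTheory Opposite

universe w v v' u u'

namespace PreFrobenioid

namespace BiratUnits

variable {D : Type u} [Category.{v} D] {Φ : Dᵒᵖ ⥤ CommMonCat.{w}}
  {C : Type u'} [Category.{v'} C] {F : C ⥤ ElemFrobenioid Φ} {hF : IsFrobenioid F} {A A' : C}

/-- **Units commuting with `ψ` in `C` are intertwined along `ψ` in `C^birat`**: if `u ≫ ψ = ψ ≫ v` for units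
`u ∈ O^×(A)`, `v ∈ O^×(A')`, then `Intertwines ψ [(id, u)] [(id, v)]` (refinement `κ = id_A`, `l = ψ`).
[cite: MochizukiFrdI2008, Prop. 2.2(ii) p.45] -/
theorem intertwines_unitsToBirat_of_comm (ψ : A ⟶ A') (u : unitsSubgroup F A) (v : unitsSubgroup F A')
    (h : u.1.hom ≫ ψ = ψ ≫ v.1.hom) :
    Intertwines hF ψ (unitsToBirat hF A u) (unitsToBirat hF A' v) := by
  refine ⟨unitFrac hF A u, unitFrac hF A' v, A, 𝟙 A, ψ, rfl, rfl, isCoAngularPreStep_id hF A, ?_, ?_⟩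
  · change ψ ≫ 𝟙 A' = 𝟙 A ≫ 𝟙 A ≫ ψ
    rw [Category.comp_id, Category.id_comp, Category.id_comp]
  · change ψ ≫ v.1.hom = 𝟙 A ≫ u.1.hom ≫ ψ
    rw [Category.id_comp, h]

/-- The same with the square given as `ψ ≫ v = u ≫ ψ`. [cite: MochizukiFrdI2008, Prop. 2.2(ii) p.45] -/
theorem intertwines_unitsToBirat_of_comm' (ψ : A ⟶ A') (u : unitsSubgroup F A) (v : unitsSubgroup F A')
    (h : ψ ≫ v.1.hom = u.1.hom ≫ ψ) :
    Intertwines hF ψ (unitsToBirat hF A u) (unitsToBirat hF A' v) :=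
  intertwines_unitsToBirat_of_comm ψ u v h.symm

/-- In particular every unit is intertwined with itself along the identity. [cite: MochizukiFrdI2008, Prop. 2.2(ii) p.45] -/
theorem intertwines_unitsToBirat_id (u : unitsSubgroup F A) :
    Intertwines hF (𝟙 A) (unitsToBirat hF A u) (unitsToBirat hF A u) :=
  intertwines_unitsToBirat_of_comm (𝟙 A) u u (by rw [Category.comp_id, Category.id_comp])

end BiratUnits

end PreFrobenioid

end Literature.AlgebraicGeometry.Frobenioids
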